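import Literature.Probability.RandomPlanarGeometry.RestrictionDensity
import Literature.Probability.RandomPlanarGeometry.HullApproximationProofs
import HarnessLib

/-!
# Density of `𝒜₀` in `𝒬₊` ([LSW] Lemma 3.5): reduction to the hulls `E_δ` bounded by a simple path

G. F. Lawler, O. Schramm, W. Werner, *Conformal restriction: the chordal case*, J. Amer. Math.
Soc. **16** (2003) 917–955, arXiv:math/0209343 (**[LSW]**, arXiv page numbers), proof of
Lemma 3.5, p. 13:

> "To complete the proof of the Lemma, we now show that `𝒜₀` is dense in `𝒬₊`. Let `A ∈ 𝒬₊`.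
> Set `A' := A ∪ [x₀, x₁]` … Let `E_δ` denote the closure of `A ∪ Φ_A⁻¹(D_δ)`. It is clear that
> `E_δ → A` as `δ → 0+` in the topology considered above. It thus suffices to approximate `E_δ`.
> Note that `∂E_δ ∩ ℍ̄` is a simple path, say `β : [0, s] → ℍ̄` with `β(0), β(s) ∈ ℝ`. We may
> assume that `β` is parametrized by half-plane capacity … By the chordal version of Loewner's
> theorem, we have `∂_t g_t(z) = 2/(g_t(z) - U_t)`. … Since `Ũ_t` is continuous and positive,
> there is a sequence of piecewise constant functions `Ũ^{(n)}` … Then, clearly,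
> `Φ^{(n)}_s(z) → Φ_s(z) = Φ_{E_δ}` locally uniformly in `ℍ̄ ∖ E_δ`. Note that the solution of
> (3.4) with `Ũ_t` constant is of the form `G^λ_{t'}` … It follows that `Φ^{(n)}_s` is in the
> semigroup generated by `{G^λ_t : λ > 0, t ≥ 0}`. Hence, `𝒜₀` is dense in `𝒬₊`."

The named fact `IsPlusHull.exists_isLSWGenerated_lswConverges` (`RestrictionDensity`) is this
density statement. The printed proof has two halves of very different depth:

1. **`E_δ → A`** (outer approximation of `A' = A ∪ [x₀, x₁]` by hulls whose boundary in `ℍ` is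
   a simple path with two real endpoints, the tree's `IsArcHull`), which is PROVED in the tree:
   `IsPlusHull.exists_antitone_isArcHull_holds` (`HullApproximationProofs`; [LSW] Lemma 2.1 with
   the Lemma 3.5 convergence).
2. **`𝒜₀ ∋ A_n → E_δ`** (Loewner's slit theorem for the boundary path of `E_δ`, approximation of
   the normalized driving function by step functions, stability of the Loewner flow, and
   `G^λ_{t'} = Φ_{λK_{t'}}`), which needs the converse half of Loewner's theory (simple curve ⇒
   continuous driving function, Lawler (2005) Prop. 4.4) that the tree does not have (its
   `LoewnerChain`/`LoewnerFlow` go from the driving function to the hulls only).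

This file isolates half 2 as its own NAMED FACT and PROVES the reduction of the density
statement to it:

* `Literature.Probability.RandomPlanarGeometry.LSWClosedConverges A Φ An Φn` — the convergence
  `A_n → A` of the proof of Lemma 3.5 (p. 12: "`Φ_{A_n}` converges to `Φ_A` uniformly on compact
  subsets of `ℍ̄ ∖ A` and `⋃ₙ A_n` is bounded away from `0` and `∞`") read on ALL compact subsets
  `S` of the CLOSED half-plane missing `A' = realFill A` (eventual disjointness `S ∩ A_n = ∅`, so
  that the maps are defined, and uniform convergence on `S ∩ ℍ`); it implies the tree's
  `LSWConverges` (`LSWClosedConverges.lswConverges`), which keeps only the compacts of the open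
  set `ℍ ∖ A` and one half-disc about `0`;
* NAMED FACT `Literature.Probability.RandomPlanarGeometry.IsArcHull.exists_isLSWGenerated_lswClosedConverges`
  — half 2 verbatim: every `+`-hull whose boundary in `ℍ` is a simple path with two real
  endpoints (`IsArcHull ∧ IsPlusHull`, the hulls `E_δ`) is the limit, in this sense, of hulls
  `A_n ∈ 𝒜₀` (`IsLSWGenerated`);
* PROVED `Literature.Probability.RandomPlanarGeometry.IsPlusHull.exists_isLSWGenerated_lswConverges_of_arcHull`
  — **the density of `𝒜₀` in `𝒬₊` follows**: for `A = ∅` take `A_n = ∅ = K_0 ∈ 𝒜₀`; for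
  nonempty `A ∈ 𝒬₊` take the arc hulls `J_n ↓ A'` of half 1, approximate each `J_n` by
  `B_{n,m} ∈ 𝒜₀`, and extract a diagonal sequence `B_{n,m(n)} → A` using a compact exhaustion of
  `ℍ ∖ A`, the uniform annulus `realFill J_n ⊆ realFill J_0 ⊆ {δ₀ ≤ |z| ≤ 1/δ₀}`, and the
  compacts `B̄(0, ρ) ∩ ℍ̄`, `{R + 1 ≤ |z| ≤ R'} ∩ ℍ̄` of `ℍ̄ ∖ J_n'` to localise the `B_{n,m}`.

Discharging the named fact (future work, recorded here as the plan): slits `β[0, u] ↑ E_δ`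
converge by a Carathéodory kernel theorem for hulls (cf. `KernelConvergence`); a slit is the
Loewner hull of a continuous driving function (Lawler (2005) Prop. 4.4, Lemma 4.2, Remark 4.5);
the normalized flow `∂_t Φ = 2Φ/((Φ - Ũ)Ũ)` is stable under `Ũ^{(n)} → Ũ` (Gronwall) and a
constant piece `Ũ ≡ λ` of duration `Δ` is `G^λ_{Δ/λ²} = Φ_{λK_{Δ/λ²}}` (`LoewnerSemigroup`).

## References

* [LSW] Lemma 3.5 and its proof, arXiv pp. 12–13 [LawlerSchrammWerner2003Restriction].
* G. F. Lawler, *Conformally Invariant Processes in the Plane*, AMS (2005), §4.1 (Prop. 4.4,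
  Lemma 4.2, Remark 4.5: a simple curve parametrized by capacity has a continuous driving
  function) [Lawler2005].
-/

noncomputable section

open Set Filter Topology Metric Complex Bornology
open UpperHalfPlane (upperHalfPlaneSet isOpen_upperHalfPlaneSet)
open scoped NNReal Pointwise

namespace Literature.Probability.RandomPlanarGeometry

open RestrictionConfig Loewner

/-! ### The convergence of Lemma 3.5 on compacts of the closed half-plane -/

/-- **`A_n → A` in the sense of [LSW], proof of Lemma 3.5 (p. 12), read on the closed
half-plane**: (i) `⋃ₙ A_n ⊆ {δ ≤ |z| ≤ 1/δ}`; (ii) for every compact `S ⊆ ℍ̄` missing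
`A' = A ∪ [x₀, x₁]` (`realFill A`; the printed "`ℍ̄ ∖ A`", the real gap points of `A` being
excluded as in `LSWConverges`): `S ∩ A_n = ∅` for all large `n` (so that `Φ_{A_n}` and its
boundary extension are defined on `S`) and `Φ_{A_n} → Φ_A` uniformly on `S ∩ ℍ` (where the maps
live; for the continuous boundary extensions this is uniform convergence on `S`).
[cite: LawlerSchrammWerner2003Restriction, proof of Lemma 3.5 (p. 12), definition of convergence] -/
def LSWClosedConverges (A : Set ℂ) (Φ : ConformalEquiv (upperHalfPlaneSet \ A) upperHalfPlaneSet)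
    (An : ℕ → Set ℂ) (Φn : ∀ n, ConformalEquiv (upperHalfPlaneSet \ An n) upperHalfPlaneSet) :
    Prop :=
  (∃ δ : ℝ, 0 < δ ∧ ∀ n, An n ⊆ {z : ℂ | δ ≤ ‖z‖ ∧ ‖z‖ ≤ δ⁻¹}) ∧
    ∀ S : Set ℂ, IsCompact S → S ⊆ closure upperHalfPlaneSet → Disjoint S (realFill A) →
      (∀ᶠ n in atTop, Disjoint S (An n)) ∧
        TendstoUniformlyOn (fun n ↦ (Φn n : ℂ → ℂ)) Φ atTop (S ∩ upperHalfPlaneSet)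

namespace LSWClosedConverges

variable {A : Set ℂ} {Φ : ConformalEquiv (upperHalfPlaneSet \ A) upperHalfPlaneSet}
  {An : ℕ → Set ℂ} {Φn : ∀ n, ConformalEquiv (upperHalfPlaneSet \ An n) upperHalfPlaneSet}

/-- The hulls `A_n` are bounded away from `0` and `∞`. [folklore] -/
theorem exists_bound (h : LSWClosedConverges A Φ An Φn) :
    ∃ δ : ℝ, 0 < δ ∧ ∀ n, An n ⊆ {z : ℂ | δ ≤ ‖z‖ ∧ ‖z‖ ≤ δ⁻¹} :=
  h.1

/-- Compacts of `ℍ̄ ∖ A'` are eventually disjoint from `A_n`. [folklore] -/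
theorem eventually_disjoint (h : LSWClosedConverges A Φ An Φn) {S : Set ℂ} (hS : IsCompact S)
    (hSH : S ⊆ closure upperHalfPlaneSet) (hSA : Disjoint S (realFill A)) :
    ∀ᶠ n in atTop, Disjoint S (An n) :=
  (h.2 S hS hSH hSA).1

/-- Uniform convergence `Φ_{A_n} → Φ_A` on the `ℍ`-part of compacts of `ℍ̄ ∖ A'`. [folklore] -/
theorem tendstoUniformlyOn (h : LSWClosedConverges A Φ An Φn) {S : Set ℂ} (hS : IsCompact S)
    (hSH : S ⊆ closure upperHalfPlaneSet) (hSA : Disjoint S (realFill A)) :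
    TendstoUniformlyOn (fun n ↦ (Φn n : ℂ → ℂ)) Φ atTop (S ∩ upperHalfPlaneSet) :=
  (h.2 S hS hSH hSA).2

/-- Uniform convergence on compacts of the open set `ℍ ∖ A` (which miss `A'` automatically,
`A'` adding only real points). [folklore] -/
theorem tendstoUniformlyOn_of_subset (h : LSWClosedConverges A Φ An Φn) {S : Set ℂ}
    (hS : IsCompact S) (hSA : S ⊆ upperHalfPlaneSet \ A) :
    (∀ᶠ n in atTop, Disjoint S (An n)) ∧
      TendstoUniformlyOn (fun n ↦ (Φn n : ℂ → ℂ)) Φ atTop S := by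
  have hSH : S ⊆ closure upperHalfPlaneSet := fun z hz ↦ subset_closure (hSA hz).1
  have hSA' : Disjoint S (realFill A) := Set.disjoint_left.2 fun z hz hzF ↦
    (hSA hz).2 (realFill_inter_upperHalfPlaneSet_subset A ⟨hzF, (hSA hz).1⟩)
  refine ⟨h.eventually_disjoint hS hSH hSA', ?_⟩
  have := h.tendstoUniformlyOn hS hSH hSA'
  rwa [inter_eq_left.2 fun z hz ↦ (hSA hz).1] at this

/-- **The closed-half-plane convergence implies the convergence `LSWConverges`** of
`RestrictionDensity` (compacts of `ℍ ∖ A`, and the half-disc `B(0, ρ) ∩ ℍ` for any `ρ` with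
`B̄(0, ρ) ∩ A' = ∅`, which exists as soon as `0 ∉ A'` and `A'` is closed — e.g. for a nonempty
`A ∈ 𝒬₊`). [folklore] -/
theorem lswConverges (h : LSWClosedConverges A Φ An Φn) (hAc : IsClosed (realFill A))
    (h0 : (0 : ℂ) ∉ realFill A) : LSWConverges A Φ An Φn := by
  refine ⟨h.exists_bound, fun S hS hSA ↦ h.tendstoUniformlyOn_of_subset hS hSA, ?_⟩
  -- a closed ball about `0` missing `A'`
  obtain ⟨ε, hε, hεA⟩ := Metric.isOpen_iff.1 hAc.isOpen_compl 0 h0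
  refine ⟨ε / 2, half_pos hε, ?_⟩
  have hK : IsCompact (closedBall (0 : ℂ) (ε / 2) ∩ closure upperHalfPlaneSet) :=
    (isCompact_closedBall _ _).inter_right isClosed_closure
  have hKA : Disjoint (closedBall (0 : ℂ) (ε / 2) ∩ closure upperHalfPlaneSet) (realFill A) :=
    Set.disjoint_left.2 fun z hz hzF ↦ hεA (closedBall_subset_ball (by linarith) hz.1) hzF
  refine (h.tendstoUniformlyOn hK inter_subset_right hKA).mono ?_
  rintro z ⟨hzH, hzb⟩
  exact ⟨⟨ball_subset_closedBall hzb, subset_closure hzH⟩, hzH⟩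

end LSWClosedConverges

/-! ### Named fact: the hulls `E_δ` are limits of `𝒜₀` -/

/-- NAMED FACT — **the hulls bounded by a simple path are limits of `𝒜₀`** ([LSW] proof of
Lemma 3.5, p. 13, the Loewner half of the density proof, verbatim: "It thus suffices to
approximate `E_δ`. Note that `∂E_δ ∩ ℍ̄` is a simple path, say `β : [0, s] → ℍ̄` with
`β(0), β(s) ∈ ℝ`. We may assume that `β` is parametrized by half-plane capacity from `∞`, so that
`a(β[0, t]) = 2t`, `t ∈ [0, s]`. Set `g_t := g_{β[0,t]}`, `Φ_t := Φ_{β[0,t]} = g_t - g_t(0)`,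
`U_t := g_t(β(t))`, `Ũ_t := U_t - g_t(0) = Φ_t(β(t))`, `t ∈ [0, s]`. By the chordal version of
Loewner's theorem, we have `∂_t g_t(z) = 2/(g_t(z) - U_t)`. Thus,
`∂_t Φ_t(z) = 2Φ_t(z)/((Φ_t(z) - Ũ_t)Ũ_t)`, `Φ_0(z) = z` (3.4). Since `Ũ_t` is continuous and
positive, there is a sequence of piecewise constant functions `Ũ^{(n)} : [0, s] → (0, ∞)` such
that `sup{|Ũ^{(n)}_t - Ũ_t| : t ∈ [0, s]} → 0` as `n → ∞`. Let `Φ^{(n)}_t` be the solution of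
(3.4) with `Ũ^{(n)}_t` replacing `Ũ_t`. Then, clearly, `Φ^{(n)}_s(z) → Φ_s(z) = Φ_{E_δ}` locally
uniformly in `ℍ̄ ∖ E_δ`. Note that the solution of (3.4) with `Ũ_t` constant is of the form
`G^λ_{t'}`, where `λ = Ũ_0` and `t'` is some function of `t` and `Ũ_0`. It follows that `Φ^{(n)}_s`
is in the semigroup generated by `{G^λ_t : λ > 0, t ≥ 0}`"). Stated for the hulls the argument is
applied to: `A ∈ 𝒬₊` whose boundary in `ℍ` is a simple path with two (distinct) real endpoints
(`IsArcHull`, the property [LSW] use of `E_δ`; the tree's `E_δ` are such,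
`IsPlusHull.isArcHull_arcHull`), with any restriction map `Φ_A` (unique on `ℍ ∖ A`); the
conclusion is the convergence `A_n → A` of p. 12 on compacts of `ℍ̄ ∖ A` (`LSWClosedConverges`;
for these hulls `A' = A ∪ [x₀, x₁]` differs from `A` at most by real points, where no map is
evaluated) with `A_n ∈ 𝒜₀` (`IsLSWGenerated`) and restriction maps `Φ_{A_n}`. The proof needs
Loewner's slit theorem (Lawler (2005), Prop. 4.4), not in the tree.
[cite: LawlerSchrammWerner2003Restriction, proof of Lemma 3.5 (p. 13), approximation of E_δ by 𝒜₀] -/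
def IsArcHull.exists_isLSWGenerated_lswClosedConverges : Prop :=
  ∀ {A : Set ℂ}, IsArcHull A → IsPlusHull A →
    ∀ {Φ : ConformalEquiv (upperHalfPlaneSet \ A) upperHalfPlaneSet}, IsRestrictionMap A Φ →
      ∃ (An : ℕ → Set ℂ) (Φn : ∀ n, ConformalEquiv (upperHalfPlaneSet \ An n) upperHalfPlaneSet),
        (∀ n, IsLSWGenerated (An n)) ∧ (∀ n, IsRestrictionMap (An n) (Φn n)) ∧
          LSWClosedConverges A Φ An Φn

/-! ### Elementary lemmas for the diagonal argument -/

section Lemmas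

variable {A : Set ℂ}

/-- `∅ = K_0 ∈ 𝒜₀` (the Loewner hull at time `0` is empty, `Loewner.hull_zero_holds`). [folklore] -/
theorem isLSWGenerated_empty : IsLSWGenerated (∅ : Set ℂ) := by
  have h0 : lswHull 0 = ∅ := by
    rw [lswHull, hull_zero_holds continuous_lswDriving, closure_empty]
  simpa [h0] using IsLSWGenerated.smul_lswHull one_pos 0

/-- A restriction map of the empty hull is the identity on `ℍ`. [folklore] -/
theorem IsRestrictionMap.eq_self_of_empty {Φ : ConformalEquiv (upperHalfPlaneSet \ ∅) upperHalfPlaneSet}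
    (hΦ : IsRestrictionMap ∅ Φ) {z : ℂ} (hz : z ∈ upperHalfPlaneSet) : Φ z = z := by
  obtain ⟨Φ₀, -, hU⟩ := IsStarHull.existsUnique_isRestrictionMap_holds isStarHull_empty
  have hz' : z ∈ upperHalfPlaneSet \ (∅ : Set ℂ) := ⟨hz, notMem_empty _⟩
  rw [hU Φ hΦ hz', ← hU restrictionMapEmpty isRestrictionMap_empty hz', restrictionMapEmpty_apply]

/-- The real filling is monotone on sets with nonempty bounded real traces. [folklore] -/
theorem realFill_mono {A B : Set ℂ} (hAB : A ⊆ B) (hAne : (realTrace A).Nonempty)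
    (hBb : BddBelow (realTrace B)) (hBa : BddAbove (realTrace B)) : realFill A ⊆ realFill B := by
  have hT : realTrace A ⊆ realTrace B := fun x hx ↦ hAB hx
  rintro z (hz | ⟨x, hx, rfl⟩)
  · exact Or.inl (hAB hz)
  · refine Or.inr ⟨x, ⟨?_, ?_⟩, rfl⟩
    · exact (csInf_le_csInf hBb hAne hT).trans hx.1
    · exact hx.2.trans (csSup_le_csSup hBa hAne hT)

/-- The real filling of a compact set is compact. [folklore] -/
theorem isCompact_realFill (hA : IsCompact A) : IsCompact (realFill A) :=
  hA.union (isCompact_Icc.image continuous_ofReal)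

/-- The real filling of a set in `ℍ̄` lies in `ℍ̄`. [folklore] -/
theorem realFill_subset_closure (hA : A ⊆ closure upperHalfPlaneSet) :
    realFill A ⊆ closure upperHalfPlaneSet := by
  rintro z (hz | ⟨x, -, rfl⟩)
  · exact hA hz
  · rw [show upperHalfPlaneSet = {z : ℂ | 0 < z.im} from rfl, closure_setOf_lt_im]
    simp

/-- A set `S ⊆ ℍ` missing `B` misses `realFill B`. [folklore] -/
theorem disjoint_realFill_of_subset {S B : Set ℂ} (hS : S ⊆ upperHalfPlaneSet) (hSB : Disjoint S B) :
    Disjoint S (realFill B) :=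
  Set.disjoint_left.2 fun _ hz hzF ↦
    Set.disjoint_left.1 hSB hz (realFill_inter_upperHalfPlaneSet_subset B ⟨hzF, hS hz⟩)

/-- **Compact exhaustion of `ℍ ∖ A`**: the compacts
`K_k = {Im z ≥ 1/(k+1)} ∩ B̄(0, k+1) ∩ {dist(z, A) ≥ 1/(k+1)}`. [folklore] -/
def diffExhaustion (A : Set ℂ) (k : ℕ) : Set ℂ :=
  {z : ℂ | ((k : ℝ) + 1)⁻¹ ≤ z.im} ∩ closedBall (0 : ℂ) ((k : ℝ) + 1) ∩
    {z : ℂ | ((k : ℝ) + 1)⁻¹ ≤ infDist z A}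

/-- The exhausting sets are compact. [folklore] -/
theorem isCompact_diffExhaustion (A : Set ℂ) (k : ℕ) : IsCompact (diffExhaustion A k) := by
  refine ((isCompact_closedBall (0 : ℂ) ((k : ℝ) + 1)).inter_left
    (isClosed_le continuous_const continuous_im)).inter_right
    (isClosed_le continuous_const (continuous_infDist_pt A))

/-- The exhausting sets lie in `ℍ ∖ A`. [folklore] -/
theorem diffExhaustion_subset (A : Set ℂ) (k : ℕ) :
    diffExhaustion A k ⊆ upperHalfPlaneSet \ A := by
  rintro z ⟨⟨hzi, -⟩, hzd⟩
  have hk : (0 : ℝ) < ((k : ℝ) + 1)⁻¹ := by positivity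
  refine ⟨show 0 < z.im from hk.trans_le hzi, fun hzA ↦ ?_⟩
  have := infDist_zero_of_mem hzA
  simp only [mem_setOf_eq, this] at hzd
  exact absurd hzd (not_le.2 hk)

/-- Every compact subset of `ℍ ∖ A` (`A` closed nonempty) lies in some exhausting set. [folklore] -/
theorem exists_subset_diffExhaustion (hAc : IsClosed A) (hne : A.Nonempty) {S : Set ℂ}
    (hS : IsCompact S) (hSA : S ⊆ upperHalfPlaneSet \ A) : ∃ k, S ⊆ diffExhaustion A k := by
  rcases S.eq_empty_or_nonempty with rfl | hSne
  · exact ⟨0, empty_subset _⟩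
  -- positive lower bounds for `Im` and `dist(·, A)` on `S`, and a bound on the norm
  obtain ⟨z₁, hz₁, h₁⟩ := hS.exists_isMinOn hSne continuous_im.continuousOn
  obtain ⟨z₂, hz₂, h₂⟩ := hS.exists_isMinOn hSne (continuous_infDist_pt A).continuousOn
  obtain ⟨R, hR⟩ := hS.isBounded.subset_closedBall 0
  have hi : 0 < z₁.im := (hSA hz₁).1
  have hd : 0 < infDist z₂ A := (hAc.notMem_iff_infDist_pos hne).1 (hSA hz₂).2
  -- choose `k` large
  obtain ⟨k, hk⟩ := exists_nat_gt (max (max z₁.im⁻¹ (infDist z₂ A)⁻¹) R)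
  have hk₁ : z₁.im⁻¹ < (k : ℝ) + 1 := by
    linarith [le_max_left (max z₁.im⁻¹ (infDist z₂ A)⁻¹) R, le_max_left z₁.im⁻¹ (infDist z₂ A)⁻¹]
  have hk₂ : (infDist z₂ A)⁻¹ < (k : ℝ) + 1 := by
    linarith [le_max_left (max z₁.im⁻¹ (infDist z₂ A)⁻¹) R, le_max_right z₁.im⁻¹ (infDist z₂ A)⁻¹]
  have hk₃ : R ≤ (k : ℝ) + 1 := by
    linarith [le_max_right (max z₁.im⁻¹ (infDist z₂ A)⁻¹) R]
  refine ⟨k, fun z hz ↦ ⟨⟨?_, ?_⟩, ?_⟩⟩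
  · have : ((k : ℝ) + 1)⁻¹ < z₁.im := by rwa [inv_lt_comm₀ (by positivity) hi]
    exact this.le.trans (h₁ hz)
  · exact closedBall_subset_closedBall hk₃ (hR hz)
  · have : ((k : ℝ) + 1)⁻¹ < infDist z₂ A := by rwa [inv_lt_comm₀ (by positivity) hd]
    exact this.le.trans (h₂ hz)

end Lemmas

/-! ### The density of `𝒜₀` in `𝒬₊` from the approximation of the hulls `E_δ` -/

section Assembly

/-- The empty hull is the limit of the constant sequence `∅ = K_0 ∈ 𝒜₀` (its restriction maps
are the identity on `ℍ`). [folklore] -/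
theorem lswConverges_empty {Φ : ConformalEquiv (upperHalfPlaneSet \ ∅) upperHalfPlaneSet}
    (hΦ : IsRestrictionMap ∅ Φ) :
    LSWConverges ∅ Φ (fun _ ↦ ∅) (fun _ ↦ restrictionMapEmpty) := by
  have hconv : ∀ S ⊆ upperHalfPlaneSet,
      TendstoUniformlyOn (fun (_ : ℕ) ↦ (restrictionMapEmpty : ℂ → ℂ)) Φ atTop S := by
    intro S hS
    rw [Metric.tendstoUniformlyOn_iff]
    intro ε hε
    exact Eventually.of_forall fun n z hz ↦ by
      rw [restrictionMapEmpty_apply, hΦ.eq_self_of_empty (hS hz), dist_self]; exact hε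
  exact ⟨⟨1, one_pos, fun _ ↦ empty_subset _⟩,
    fun S _ hSA ↦ ⟨Eventually.of_forall fun _ ↦ disjoint_empty S, hconv S fun z hz ↦ (hSA hz).1⟩,
    ⟨1, one_pos, hconv _ inter_subset_left⟩⟩

/-- **The density of `𝒜₀` in `𝒬₊` ([LSW] Lemma 3.5), from the outer approximation by the hulls
`E_δ` (proved in the tree, `IsPlusHull.exists_antitone_isArcHull_holds`) and the approximation of
each `E_δ` by `𝒜₀` (the named fact `IsArcHull.exists_isLSWGenerated_lswClosedConverges`)** — the
structure of the printed proof (p. 13: "It is clear that `E_δ → A` as `δ → 0+` in the topology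
considered above. It thus suffices to approximate `E_δ`."), the "it thus suffices" being a diagonal
extraction: with `J_n ↓ A' ` the arc hulls and `B_{n,m} → J_n` their `𝒜₀` approximants, choose
`m(n)` so that `B_{n,m(n)}` misses `B̄(0, ρ) ∩ ℍ̄`, `{R + 1 ≤ |z| ≤ R'_n} ∩ ℍ̄` and the first `n`
sets of a compact exhaustion of `ℍ ∖ A` that miss `J_n`, with `|Φ_{B_{n,m(n)}} - Φ_{J_n}| < 1/(n+1)`
there; then `B_{n,m(n)} → A`.
[cite: LawlerSchrammWerner2003Restriction, Lemma 3.5 and its proof (pp. 12–13)] -/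
theorem IsPlusHull.exists_isLSWGenerated_lswConverges_of_arcHull
    (harc : IsArcHull.exists_isLSWGenerated_lswClosedConverges) :
    IsPlusHull.exists_isLSWGenerated_lswConverges := by
  intro A hA Φ hΦ
  rcases A.eq_empty_or_nonempty with rfl | hne
  · exact ⟨fun _ ↦ ∅, fun _ ↦ restrictionMapEmpty, fun _ ↦ isLSWGenerated_empty,
      fun _ ↦ isRestrictionMap_empty, lswConverges_empty hΦ⟩
  -- Step 1: the arc hulls `J n ↓ A'` and their restriction maps `Ψ n → Φ`
  obtain ⟨J, hJa, hJp, hJm, hJi, hJconv⟩ := IsPlusHull.exists_antitone_isArcHull_holds hA hne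
  have hΨex : ∀ n, ∃ Ψ : ConformalEquiv (upperHalfPlaneSet \ J n) upperHalfPlaneSet,
      IsRestrictionMap (J n) Ψ := fun n ↦ by
    obtain ⟨Ψ, hΨ, -⟩ := IsStarHull.existsUnique_isRestrictionMap_holds (hJp n).1
    exact ⟨Ψ, hΨ⟩
  choose Ψ hΨ using hΨex
  have hcv := (hJconv hΦ hΨ).1
  -- Step 2: the `𝒜₀` approximants `B n m → J n` of each arc hull
  have hBex : ∀ n, ∃ (B : ℕ → Set ℂ)
      (χ : ∀ m, ConformalEquiv (upperHalfPlaneSet \ B m) upperHalfPlaneSet),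
      (∀ m, IsLSWGenerated (B m)) ∧ (∀ m, IsRestrictionMap (B m) (χ m)) ∧
        LSWClosedConverges (J n) (Ψ n) B χ := fun n ↦ harc (hJa n) (hJp n) (hΨ n)
  choose B χ hBgen hχ hBconv using hBex
  choose δ' hδ'pos hδ' using fun n ↦ (hBconv n).exists_bound
  -- Step 3: constants. `F0 = realFill (J 0)` contains every `realFill (J n)` and `realFill A`
  set F0 : Set ℂ := realFill (J 0) with hF0
  have hAJ : ∀ n, A ⊆ J n := fun n ↦ (subset_realFill A).trans (subset_of_iInter_eq hJi n)
  have hJne : ∀ n, (J n).Nonempty := fun n ↦ hne.mono (hAJ n)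
  have hJcpt : ∀ n, IsCompact (J n) := fun n ↦ (hJp n).1.isBoundedHull.isCompact
  have hJcl : ∀ n, IsClosed (J n) := fun n ↦ (hJp n).1.isBoundedHull.isClosed
  have hTb : BddBelow (realTrace (J 0)) := (hJp 0).isCompact_realTrace.bddBelow
  have hTa : BddAbove (realTrace (J 0)) := (hJp 0).isCompact_realTrace.bddAbove
  have hFn : ∀ n, realFill (J n) ⊆ F0 := fun n ↦
    realFill_mono (hJm (Nat.zero_le n)) ((hJp n).1.isBoundedHull.realTrace_nonempty (hJne n))
      hTb hTa
  have hFA : realFill A ⊆ F0 :=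
    realFill_mono (hAJ 0) (hA.1.isBoundedHull.realTrace_nonempty hne) hTb hTa
  have hF0c : IsCompact F0 := isCompact_realFill (hJcpt 0)
  have hF00 : (0 : ℂ) ∉ F0 := (hJp 0).zero_notMem_realFill (hJne 0)
  obtain ⟨ε, hε, hεF⟩ := Metric.isOpen_iff.1 hF0c.isClosed.isOpen_compl 0 hF00
  obtain ⟨R, hR0, hR⟩ := hF0c.isBounded.subset_closedBall_lt 0 0
  set ρ : ℝ := ε / 2 with hρ
  have hρpos : 0 < ρ := by positivity
  have hρε : ρ < ε := by rw [hρ]; linarith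
  -- the localising compacts `S₁ = B̄(0, ρ) ∩ ℍ̄` and `S₂ n = {R + 1 ≤ |z| ≤ R₂ n} ∩ ℍ̄`
  set S₁ : Set ℂ := closedBall (0 : ℂ) ρ ∩ closure upperHalfPlaneSet with hS₁
  have hS₁c : IsCompact S₁ := (isCompact_closedBall _ _).inter_right isClosed_closure
  have hS₁F : ∀ n, Disjoint S₁ (realFill (J n)) := fun n ↦
    Set.disjoint_left.2 fun z hz hzF ↦ hεF (closedBall_subset_ball hρε hz.1) (hFn n hzF)
  set R₂ : ℕ → ℝ := fun n ↦ max (R + 1) (δ' n)⁻¹ with hR₂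
  set S₂ : ℕ → Set ℂ := fun n ↦
    (closedBall (0 : ℂ) (R₂ n) \ ball 0 (R + 1)) ∩ closure upperHalfPlaneSet with hS₂
  have hS₂c : ∀ n, IsCompact (S₂ n) := fun n ↦
    ((isCompact_closedBall _ _).diff isOpen_ball).inter_right isClosed_closure
  have hS₂F : ∀ n, Disjoint (S₂ n) (realFill (J n)) := fun n ↦
    Set.disjoint_left.2 fun z hz hzF ↦ by
      have h1 : ‖z‖ ≤ R := by simpa using hR (hFn n hzF)
      have h2 : ¬ ‖z‖ < R + 1 := by simpa using hz.1.2
      exact h2 (by linarith)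
  -- the compact exhaustion of `ℍ ∖ A`
  set K : ℕ → Set ℂ := diffExhaustion A with hK
  have hKH : ∀ k, K k ⊆ upperHalfPlaneSet := fun k z hz ↦ (diffExhaustion_subset A k hz).1
  have hKA : ∀ k, Disjoint (K k) (realFill A) := fun k ↦
    disjoint_realFill_of_subset (hKH k)
      (Set.disjoint_left.2 fun z hz ↦ (diffExhaustion_subset A k hz).2)
  -- Step 4: the choice of `m n`
  have hgood : ∀ n, ∃ m,
      Disjoint S₁ (B n m) ∧ Disjoint (S₂ n) (B n m) ∧
        (∀ z ∈ S₁ ∩ upperHalfPlaneSet, dist (Ψ n z) (χ n m z) < 1 / ((n : ℝ) + 1)) ∧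
        ∀ k ∈ Finset.range (n + 1), Disjoint (K k) (realFill (J n)) →
          Disjoint (K k) (B n m) ∧
            ∀ z ∈ K k ∩ upperHalfPlaneSet, dist (Ψ n z) (χ n m z) < 1 / ((n : ℝ) + 1) := by
    intro n
    have hn1 : (0 : ℝ) < 1 / ((n : ℝ) + 1) := by positivity
    have e1 := (hBconv n).eventually_disjoint hS₁c inter_subset_right (hS₁F n)
    have e2 := (hBconv n).eventually_disjoint (hS₂c n) inter_subset_right (hS₂F n)
    have e3 := Metric.tendstoUniformlyOn_iff.1
      ((hBconv n).tendstoUniformlyOn hS₁c inter_subset_right (hS₁F n)) _ hn1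
    have e4 : ∀ᶠ m in atTop, ∀ k ∈ Finset.range (n + 1), Disjoint (K k) (realFill (J n)) →
        Disjoint (K k) (B n m) ∧
          ∀ z ∈ K k ∩ upperHalfPlaneSet, dist (Ψ n z) (χ n m z) < 1 / ((n : ℝ) + 1) := by
      refine (Filter.eventually_all_finset _).2 fun k _ ↦ ?_
      by_cases hdis : Disjoint (K k) (realFill (J n))
      · have hKc : IsCompact (K k) := isCompact_diffExhaustion A k
        have hKH' : K k ⊆ closure upperHalfPlaneSet := (hKH k).trans subset_closure
        filter_upwards [(hBconv n).eventually_disjoint hKc hKH' hdis,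
          Metric.tendstoUniformlyOn_iff.1 ((hBconv n).tendstoUniformlyOn hKc hKH' hdis) _ hn1]
          with m hm hm' using fun _ ↦ ⟨hm, hm'⟩
      · exact Eventually.of_forall fun m h ↦ absurd h hdis
    exact (e1.and (e2.and (e3.and e4))).exists
  choose m hm₁ hm₂ hm₃ hm₄ using hgood
  -- Step 5: the diagonal sequence `B n (m n) → A`
  have hDH : ∀ n, B n (m n) ⊆ closure upperHalfPlaneSet := fun n ↦
    (hBgen n (m n)).isStarHull.isBoundedHull.subset_closure
  refine ⟨fun n ↦ B n (m n), fun n ↦ χ n (m n), fun n ↦ hBgen n (m n), fun n ↦ hχ n (m n),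
    ?_, ?_, ?_⟩
  · -- (i) the common annulus
    refine ⟨min ρ (R + 1)⁻¹, lt_min hρpos (by positivity), fun n z hz ↦ ⟨?_, ?_⟩⟩
    · refine (min_le_left _ _).trans (le_of_not_gt fun hlt ↦ ?_)
      exact Set.disjoint_left.1 (hm₁ n) ⟨mem_closedBall_zero_iff.2 hlt.le, hDH n hz⟩ hz
    · have hzR : ‖z‖ ≤ R + 1 := le_of_not_gt fun hlt ↦ by
        refine Set.disjoint_left.1 (hm₂ n) ⟨⟨?_, ?_⟩, hDH n hz⟩ hz
        · rw [mem_closedBall_zero_iff]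
          exact ((hδ' n (m n) hz).2).trans (le_max_right _ _)
        · rw [mem_ball_zero_iff]; exact fun h ↦ absurd h (not_lt.2 hlt.le)
      have h := inv_anti₀ (lt_min hρpos (by positivity)) (min_le_right ρ (R + 1)⁻¹)
      rw [inv_inv] at h
      exact hzR.trans h
  · -- (ii) compacts of `ℍ ∖ A`
    intro S hS hSA
    obtain ⟨k, hSK⟩ := exists_subset_diffExhaustion hA.1.isBoundedHull.isClosed hne hS hSA
    have hKdisj : ∀ᶠ n in atTop, Disjoint (K k) (J n) :=
      eventually_disjoint_of_iInter_eq hJcl hJm hJi (isCompact_diffExhaustion A k) (hKA k)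
    have hKdisj' : ∀ᶠ n in atTop, Disjoint (K k) (realFill (J n)) := by
      filter_upwards [hKdisj] with n hn using disjoint_realFill_of_subset (hKH k) hn
    refine ⟨?_, ?_⟩
    · filter_upwards [hKdisj', eventually_ge_atTop k] with n hn hkn
      exact (hm₄ n k (Finset.mem_range_succ_iff.2 hkn) hn).1.mono_left hSK
    · rw [Metric.tendstoUniformlyOn_iff]
      intro e he
      have h1 := Metric.tendstoUniformlyOn_iff.1 (hcv (K k) (hKH k)
        (by rw [(isCompact_diffExhaustion A k).isClosed.closure_eq]; exact isCompact_diffExhaustion A k)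
        (by rw [(isCompact_diffExhaustion A k).isClosed.closure_eq]; exact hKA k)) (e / 2) (half_pos he)
      have h2 : ∀ᶠ n : ℕ in atTop, 1 / ((n : ℝ) + 1) < e / 2 :=
        (tendsto_one_div_add_atTop_nhds_zero_nat).eventually (gt_mem_nhds (half_pos he))
      filter_upwards [h1, h2, hKdisj', eventually_ge_atTop k] with n h1n h2n hn hkn z hz
      have h3 := (hm₄ n k (Finset.mem_range_succ_iff.2 hkn) hn).2 z ⟨hSK hz, hKH k (hSK hz)⟩
      calc dist (Φ z) (χ n (m n) z) ≤ dist (Φ z) (Ψ n z) + dist (Ψ n z) (χ n (m n) z) :=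
            dist_triangle _ _ _
        _ < e / 2 + e / 2 := add_lt_add (h1n z (hSK hz)) (h3.trans h2n)
        _ = e := by ring
  · -- (iii) the half-disc about `0`
    refine ⟨ρ, hρpos, ?_⟩
    have hcl : closure (upperHalfPlaneSet ∩ ball (0 : ℂ) ρ) ⊆ closedBall 0 ρ :=
      (closure_mono inter_subset_right).trans closure_ball_subset_closedBall
    have h0 := hcv (upperHalfPlaneSet ∩ ball (0 : ℂ) ρ) inter_subset_left
      ((isCompact_closedBall 0 ρ).of_isClosed_subset isClosed_closure hcl)
      (Set.disjoint_left.2 fun z hz hzF ↦ hεF (closedBall_subset_ball hρε (hcl hz)) (hFA hzF))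
    rw [Metric.tendstoUniformlyOn_iff] at h0 ⊢
    intro e he
    have h2 : ∀ᶠ n : ℕ in atTop, 1 / ((n : ℝ) + 1) < e / 2 :=
      (tendsto_one_div_add_atTop_nhds_zero_nat).eventually (gt_mem_nhds (half_pos he))
    filter_upwards [h0 (e / 2) (half_pos he), h2] with n h1n h2n z hz
    have h3 := hm₃ n z ⟨⟨ball_subset_closedBall hz.2, subset_closure hz.1⟩, hz.1⟩
    calc dist (Φ z) (χ n (m n) z) ≤ dist (Φ z) (Ψ n z) + dist (Ψ n z) (χ n (m n) z) :=
          dist_triangle _ _ _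
      _ < e / 2 + e / 2 := add_lt_add (h1n z hz) (h3.trans h2n)
      _ = e := by ring

end Assembly

end Literature.Probability.RandomPlanarGeometry

end
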